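import Summits.ABC.IUTFork.Cor312PilotKummerSplitWitness
import Summits.ABC.IUTFork.Repair.CandInternal3
import Summits.ABC.IUTFork.Repair.CandInternal6
import Summits.ABC.IUTFork.Repair.CandInternal9
import Summits.ABC.IUTFork.Repair.CandInternal12
import Summits.ABC.IUTFork.Repair.CandInternal15
import HarnessLib

/-!
# IUT REPAIR branch (LADDER-ABC:A2.RP), class (i) B0 — the P♮₁ cells (abc-iut-w5-d230's SPLIT natural bed: S through ONE (Ind1)
# CAPSULE PERMUTATION) of the d3 TRANSPORT rows RP-I01/I01b/I02/I02b/I08a–c/I12/I15 — RP-I15 is STRICTLY STRONGER than level C there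

Record file of the abc-iut cell's REPAIR branch (seat abc-iut-rp-d3 gen 2, class (i) d3 «mono-theta transport / [IUTchIII] Prop. 3.5»; lead
abc-iut-rp-plan; REPAIR-SPEC v0.4 §3 PROFILE RULE; companions `CandInternal6Scal` (SCAL + one-bit law) and `CandInternal6U` (U)). TAKES NO
SIDE between Mochizuki, Scholze–Stix, Joshi or anyone; nothing here asserts abc or [IUTchIII] Cor. 3.12 proved or refuted; candidates are
hypotheses — typed ≠ proved, instantiated ≠ endorsed. Closed theorems about TOY MODEL DATA, BY NAME on abc-iut-w5-d230's P♮₁ bed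
`Cor312PilotKummerSplitShells/Model/Thm311/Witness` (p431201 ff.: `splitShells` — TRIVIAL "Ism" and strip-automorphisms, two valuations, split
tensor packets —, `swapFamily ∈ (Ind1)` the swap of the capsule indices `0` and `j`, `qDatumSplit := swapFamily · {Θ-point}`, `splitSetting`,
`boxRegion`, `splitSetting_pinnedRegions3`, `splitSetting_pilotKummerIndRelated`, `splitSetting_pilotKummerCompat`, `qDatumSplit_ne_theta`,
`splitSetting_regions_ne`, engine `satNatural₁_of_holds_at_splitSetting`). DEFS-FREEZE respected; PROOF-ONLY (no definition).

WHY THIS BED MATTERS FOR THE d3 ROWS: P♮₁ realises S by print's OWN moving indeterminacy, an (Ind1) capsule permutation ([IUTchIV] Thm. 1.10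
Step (v) «symmetrizing with respect to the choice of i†»; Dupuy–Hilado §4.7), with trivial Ism. RP-I15's reading predicate `UnitsType`
(D⊢-strip isomorphism ∘ Ism on every factor, NO capsule permutation — graded FAITHFUL as a predicate shape by ref-1's TRANSPORT sheet
0e7e088d8f323944) collapses here to the IDENTITY (`unitsType_eq_one_split`), so RP-I15 FAILS (`I15_H_fails_at_split`) at a bed where the
datum-level clause C = `PilotKummerCompat` and S HOLD: **RP-I15 ⊋ C kernel-witnessed** (`I15_strictly_stronger_than_C`) — the «no capsule
permutation» clause of `UnitsType` is load-bearing and EXCLUDES the (Ind1) mechanism. Recorded for the T-d lane, not as a defect claim.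
CELLS (EVAL-LOG column «P♮₁», bed (`splitFull`, `splitSetting`, `boxRegion`, `qDatumSplit`)): RP-I02 `I02_H_at_split` HOLDS (SAT♮₁
`I02_satNatural₁`), RP-I02b `I02_HR_at_split`; RP-I12 HOLDS for every class ∋ `swapFamily` (`I12_H_of_mem`, `I12_H_closure_at_split`), the
units-type class and `{1}` FAIL (`I12_H_unitsType_fails_at_split`, `I12_H_one_fails_at_split`); RP-I15 FAILS; RP-I01/I01b FAIL
(`I01_H_fails_at_split`, `I01_H'_fails_at_split`: regions differ, `splitSetting_regions_ne` — third STRONGER-than-S witness); RP-I08a FAILS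
(`I08_H_fails_at_split`; (T1) `I08_transport_at_split` holds by `swapFamily`, (T2) `swapFamily_not_rhoInvisible`), RP-I08b `I08_HΘ_at_split`
HOLDS (Θ-side), RP-I08c `I08_HStab_fails_at_split` FAILS (`swapFamily` moves the Θ-datum). Package `profile_at_split`.
[claim: Mochizuki2012, status: disputed] [cite: ScholzeStix2018, §2.2 pp. 9–10]
-/

noncomputable section

open Set

namespace Summit.ABC.IUTFork.Repair.CandInternal6Split

open Thm311 Cor312 Cor312Vol Cor312.Checks Cor312.IdentifiedNonVacuity Cor312Vol.NaiveWitness Cor312Vol.PinnedWitness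
  Cor312Vol.SplitWitness Literature.IUT.LogThetaLattice

/-! ## 1. Over the split shells a units-type family is the identity -/

/-- **`UnitsType` collapses to the identity over the split shells** (their strip-automorphism group and "Ism" are TRIVIAL; a units-type
family permutes no capsule index): the only units-type packet family of P♮₁ is `1`. [folklore] -/
theorem unitsType_eq_one_split {Φ : splitShells.PacketAut} (hΦ : CandInternal15.UnitsType splitShells Φ) : Φ = 1 := by
  obtain ⟨h, g, hh, hg, hΦ⟩ := hΦ
  funext j vQ
  have e1 : (fun i => splitShells.summandwise vQ fun v => h j i v.1) = fun _ => LinearEquiv.refl ℚ (splitShells.Packet1 vQ) :=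
    funext fun i => summandwise_refl' vQ _ fun v => hh j i v.1
  have e2 : (fun i => splitShells.summandwise vQ (g j vQ i)) = fun _ => LinearEquiv.refl ℚ (splitShells.Packet1 vQ) :=
    funext fun i => summandwise_refl' vQ _ (hg j vQ i)
  rw [hΦ j vQ, e1, e2, splitShells.factorwise_refl]
  rfl

/-- Conversely the identity is units-type (`CandInternal15.unitsType_one`), so over the split shells `UnitsType Φ ↔ Φ = 1`. [folklore] -/
theorem unitsType_iff_eq_one_split (Φ : splitShells.PacketAut) : CandInternal15.UnitsType splitShells Φ ↔ Φ = 1 :=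
  ⟨unitsType_eq_one_split, fun h => h ▸ CandInternal15.unitsType_one splitShells⟩

/-- The column Kummer images of P♮₁ all equal the Θ-datum `{Θ-point}` (Thm. 3.11 (ii)(b) by `rfl`, columns constant). [folklore] -/
theorem split_frobΨ (n m : ℤ) (v : splitIndex.V) (hv : v ∈ splitIndex.Vbad) :
    (splitFull.toLatticeSituation.col n).frobΨ m v hv = {thetaStar v} := rfl

/-- Thm. 3.11 (ii)(b) for every column of P♮₁. [folklore] -/
theorem split_kummerB (n : ℤ) : (splitFull.toLatticeSituation.col n).KummerB (splitFull.toLatticeSituation.D n) := fun _ _ _ => rfl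

/-! ## 2. RP-I02 / RP-I12 / RP-I15 at P♮₁: the (Ind1) mover transports; no units-type family does -/

/-- **RP-I02 HOLDS at P♮₁**: the q-datum IS the transport of the Θ-datum along `swapFamily ∈ (Ind1) ⊆ ⟨(Ind1) ∪ (Ind2)⟩` (by definition of
abc-iut-w5-d230's `qDatumSplit`). [claim: Mochizuki2012, status: disputed] -/
theorem I02_H_at_split : CandInternal6.H splitFull.toLatticeSituation splitSetting qDatumSplit :=
  ⟨swapFamily, swapFamily_mem_indGroup.1, fun _ _ => rfl⟩

/-- RP-I02b (≡ S) HOLDS at P♮₁ (abc-iut-w5-d230's `splitSetting_pilotKummerIndRelated`). [claim: Mochizuki2012, status: disputed] -/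
theorem I02_HR_at_split : CandInternal6.HR splitFull.toLatticeSituation splitSetting boxRegion qDatumSplit :=
  (CandInternal6.HR_iff_S _ _ _ _).2 splitSetting_pilotKummerIndRelated

/-- **T-c for RP-I02, grade SAT♮₁** (engine `satNatural₁_of_holds_at_splitSetting`): jointly satisfiable with typed Thm. 3.11 ∧ `BridgeHyps` ∧
`|log(q)| > 0` ∧ the three pins ∧ all four levels ∧ the Statement STRICT ∧ `¬ IdentifiedReading`, the mover being print's (Ind1).
[claim: Mochizuki2012, status: disputed] -/
theorem I02_satNatural₁ :
    ∃ (T : ThetaIndex) (F : FullSituation T) (P : Cor312.Setting F.toLatticeSituation.toSituation)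
      (ρ : (∀ v : T.V, v ∈ T.Vbad → Set (F.L.StarPacket v)) → ∀ (j : T.Label) (vQ : T.VQ), Set (F.L.Packet j vQ))
      (qK : ∀ v : T.V, v ∈ T.Vbad → Set (F.L.StarPacket v)),
      F.Statement ∧ BridgeHyps P ∧ P.AbsLogQPos ∧ PinnedRegions3 F.toLatticeSituation P ρ qK ∧
        CandInternal6.H F.toLatticeSituation P qK ∧
        PilotKummerCompat F.toLatticeSituation P qK ∧ PilotKummerCompatRegion F.toLatticeSituation P ρ qK ∧
        PilotKummerIndRelated F.toLatticeSituation P ρ qK ∧ PilotKummerCompatHull F.toLatticeSituation P ρ qK ∧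
        P.Statement ∧ ((P.negLogQ : ℝ) : WithTop ℝ) < P.negLogTheta ∧ ¬ P.IdentifiedReading :=
  satNatural₁_of_holds_at_splitSetting (fun S P _ qK => CandInternal6.H S P qK) I02_H_at_split

/-- **RP-I12 at P♮₁: every class containing the capsule permutation `swapFamily` HOLDS.** [claim: Mochizuki2012, status: disputed] -/
theorem I12_H_of_mem {𝒞 : Set splitShells.PacketAut} (h : swapFamily ∈ 𝒞) :
    CandInternal12.H splitFull.toLatticeSituation splitSetting qDatumSplit 𝒞 :=
  ⟨0, swapFamily, h, fun _ _ => rfl⟩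

/-- In particular the class ⟨(Ind1) ∪ (Ind2)⟩ HOLDS at P♮₁. [claim: Mochizuki2012, status: disputed] -/
theorem I12_H_closure_at_split :
    CandInternal12.H splitFull.toLatticeSituation splitSetting qDatumSplit
      (Subgroup.closure (splitShells.Ind1Family ∪ splitShells.Ind2Family) : Set splitShells.PacketAut) :=
  I12_H_of_mem swapFamily_mem_indGroup.1

/-- **The trivial class `{1}` FAILS at P♮₁**: the q-datum is not the Θ-datum (abc-iut-w5-d230's `qDatumSplit_ne_theta`). [folklore] -/
theorem I12_H_one_fails_at_split :
    ¬ CandInternal12.H splitFull.toLatticeSituation splitSetting qDatumSplit {(1 : splitShells.PacketAut)} := by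
  rintro ⟨m₀, Φ₀, hΦ₀, hq⟩
  rw [Set.mem_singleton_iff] at hΦ₀
  subst hΦ₀
  have h := hq true rfl
  rw [split_frobΨ, LogShells.starAut_one] at h
  exact qDatumSplit_ne_theta (h.trans (by simp))

/-- **The UNITS-TYPE class FAILS at P♮₁** (it is `{1}` here, `unitsType_eq_one_split`). [folklore] -/
theorem I12_H_unitsType_fails_at_split :
    ¬ CandInternal12.H splitFull.toLatticeSituation splitSetting qDatumSplit {Φ | CandInternal15.UnitsType splitShells Φ} := by
  rintro ⟨m₀, Φ₀, hΦ₀, hq⟩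
  have h1 : Φ₀ = 1 := unitsType_eq_one_split hΦ₀
  exact I12_H_one_fails_at_split ⟨m₀, 1, Set.mem_singleton _, fun v hv => h1 ▸ hq v hv⟩

/-- **RP-I15 FAILS at P♮₁**: no units-type family carries the Θ-datum onto the q-datum — the only units-type family is the identity and the
q-datum is a genuine capsule-permutation translate. [folklore] -/
theorem I15_H_fails_at_split : ¬ CandInternal15.H splitFull.toLatticeSituation splitSetting qDatumSplit := by
  rintro ⟨m₀, Φ₀, hu, hq⟩
  exact I12_H_unitsType_fails_at_split ⟨m₀, Φ₀, hu, hq⟩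

/-- **RP-I15 IS STRICTLY STRONGER THAN LEVEL C (and than RP-I02 / S) — kernel-witnessed at P♮₁.** At abc-iut-w5-d230's split bed: typed
Thm. 3.11 ∧ `BridgeHyps` ∧ `|log(q)| > 0` ∧ the three pins ∧ `PilotKummerCompat` (level C) ∧ S ∧ the Statement STRICT all hold, RP-I02 holds,
and RP-I15 FAILS. Census content: the «no capsule permutation» clause of `UnitsType` (with trivial Ism here) EXCLUDES print's (Ind1)
mechanism; on the beds CM / U / SCAL / P♮ (one-dimensional packets, no capsule structure) RP-I15 and RP-I02 had identical cells.
[claim: Mochizuki2012, status: disputed] -/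
theorem I15_strictly_stronger_than_C :
    splitFull.Statement ∧ BridgeHyps splitSetting ∧ splitSetting.AbsLogQPos ∧
      PinnedRegions3 splitFull.toLatticeSituation splitSetting boxRegion qDatumSplit ∧
      PilotKummerCompat splitFull.toLatticeSituation splitSetting qDatumSplit ∧
      PilotKummerIndRelated splitFull.toLatticeSituation splitSetting boxRegion qDatumSplit ∧
      splitSetting.Statement ∧ ((splitSetting.negLogQ : ℝ) : WithTop ℝ) < splitSetting.negLogTheta ∧
      CandInternal6.H splitFull.toLatticeSituation splitSetting qDatumSplit ∧
      ¬ CandInternal15.H splitFull.toLatticeSituation splitSetting qDatumSplit :=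
  ⟨splitFull_statement, splitSetting_bridgeHyps, splitSetting_absLogQPos, splitSetting_pinnedRegions3, splitSetting_pilotKummerCompat,
    splitSetting_pilotKummerIndRelated, splitSetting_statement_strict.1, splitSetting_statement_strict.2, I02_H_at_split,
    I15_H_fails_at_split⟩

/-! ## 3. RP-I01 / RP-I08 at P♮₁ -/

/-- **RP-I01 FAILS at P♮₁** (although S holds): region equality without transport would identify the q-region with the Θ-region at the
label `1`, which abc-iut-w5-d230's `splitSetting_regions_ne` refutes (the pins turn `ρ qK` / `ρ Ψ` into the two pilot regions). [folklore] -/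
theorem I01_H_fails_at_split : ¬ CandInternal3.H splitFull.toLatticeSituation splitSetting boxRegion qDatumSplit := by
  rintro ⟨m₀, h⟩
  have hj := Setting.labelSucc_ne_zero (⟨0, by decide⟩ : Fin splitIndex.lstar)
  exact splitSetting_regions_ne hj () (h (Setting.labelSucc ⟨0, by decide⟩) ())

/-- RP-I01b FAILS at P♮₁ likewise (all columns carry the same Θ-datum). [folklore] -/
theorem I01_H'_fails_at_split : ¬ CandInternal3.H' splitFull.toLatticeSituation splitSetting boxRegion qDatumSplit := by
  rintro ⟨m₀, h⟩
  exact I01_H_fails_at_split ⟨m₀, h⟩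

/-- **RP-I08a FAILS at P♮₁**: a ρ-invisible transporter would give RP-I01 (`CandInternal9.hlink_of_H`). [folklore] -/
theorem I08_H_fails_at_split : ¬ CandInternal9.H splitFull.toLatticeSituation splitSetting boxRegion qDatumSplit := fun h =>
  I01_H_fails_at_split (CandInternal9.hlink_of_H _ _ _ _ h)

/-- (T1) HOLDS at P♮₁ through the capsule permutation. [claim: Mochizuki2012, status: disputed] -/
theorem I08_transport_at_split : CandInternal9.Transport splitFull.toLatticeSituation splitSetting qDatumSplit :=
  ⟨0, swapFamily, fun _ _ => rfl⟩

/-- … and `swapFamily` is NOT ρ-invisible for `boxRegion` (it moves the Θ-box onto the q-box). [folklore] -/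
theorem swapFamily_not_rhoInvisible : ¬ CandInternal9.RhoInvisible splitFull.toLatticeSituation boxRegion swapFamily := fun hinv =>
  I08_H_fails_at_split ⟨0, swapFamily, hinv, fun _ _ => rfl⟩

/-- RP-I08b (`HΘ`) HOLDS at P♮₁ (`Φ₀ = 1`: columns constant) — insufficient as everywhere. [folklore] -/
theorem I08_HΘ_at_split : CandInternal9.HΘ splitFull.toLatticeSituation splitSetting boxRegion :=
  ⟨1, CandInternal9.rhoInvisible_one _ _, fun m v hv => by rw [LogShells.starAut_one]; simp⟩

/-- **RP-I08c (`HStab`) FAILS at P♮₁**: `swapFamily ∈ ⟨(Ind1) ∪ (Ind2)⟩` moves the Θ-datum (`qDatumSplit_ne_theta`). [folklore] -/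
theorem I08_HStab_fails_at_split : ¬ CandInternal9.HStab splitFull.toLatticeSituation splitSetting := fun h =>
  qDatumSplit_ne_theta (h swapFamily swapFamily_mem_indGroup.1 0 true rfl)

/-! ## 4. The package -/

/-- **THE P♮₁ COLUMN of the class-(i) d3 profile, packaged** (abc-iut-w5-d230's split bed): interface ∧ pins ∧ S ∧ C hold (STRICT Statement,
no identification); RP-I02, RP-I02b, RP-I12(⟨Ind⟩) HOLD; RP-I15, RP-I12(units-type), RP-I12({1}), RP-I01, RP-I01b, RP-I08a FAIL; `HΘ` holds,
`HStab` fails. Census reading (neutral): where S is realised by print's (Ind1) capsule permutation, the ⟨Ind⟩-membership readings hold and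
the units-type / no-transport / ρ-invisible readings fail — RP-I15 parts from RP-I02 exactly here. [claim: Mochizuki2012, status: disputed] -/
theorem profile_at_split :
    splitFull.Statement ∧ BridgeHyps splitSetting ∧ splitSetting.AbsLogQPos ∧
      PinnedRegions3 splitFull.toLatticeSituation splitSetting boxRegion qDatumSplit ∧
      PilotKummerIndRelated splitFull.toLatticeSituation splitSetting boxRegion qDatumSplit ∧
      CandInternal6.H splitFull.toLatticeSituation splitSetting qDatumSplit ∧
      CandInternal6.HR splitFull.toLatticeSituation splitSetting boxRegion qDatumSplit ∧
      CandInternal12.H splitFull.toLatticeSituation splitSetting qDatumSplit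
        (Subgroup.closure (splitShells.Ind1Family ∪ splitShells.Ind2Family) : Set splitShells.PacketAut) ∧
      ¬ CandInternal15.H splitFull.toLatticeSituation splitSetting qDatumSplit ∧
      ¬ CandInternal12.H splitFull.toLatticeSituation splitSetting qDatumSplit {Φ | CandInternal15.UnitsType splitShells Φ} ∧
      ¬ CandInternal12.H splitFull.toLatticeSituation splitSetting qDatumSplit {(1 : splitShells.PacketAut)} ∧
      ¬ CandInternal3.H splitFull.toLatticeSituation splitSetting boxRegion qDatumSplit ∧
      ¬ CandInternal3.H' splitFull.toLatticeSituation splitSetting boxRegion qDatumSplit ∧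
      ¬ CandInternal9.H splitFull.toLatticeSituation splitSetting boxRegion qDatumSplit ∧
      CandInternal9.HΘ splitFull.toLatticeSituation splitSetting boxRegion ∧
      ¬ CandInternal9.HStab splitFull.toLatticeSituation splitSetting :=
  ⟨splitFull_statement, splitSetting_bridgeHyps, splitSetting_absLogQPos, splitSetting_pinnedRegions3, splitSetting_pilotKummerIndRelated,
    I02_H_at_split, I02_HR_at_split, I12_H_closure_at_split, I15_H_fails_at_split, I12_H_unitsType_fails_at_split, I12_H_one_fails_at_split,
    I01_H_fails_at_split, I01_H'_fails_at_split, I08_H_fails_at_split, I08_HΘ_at_split, I08_HStab_fails_at_split⟩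

end Summit.ABC.IUTFork.Repair.CandInternal6Split

end
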